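import Summits.AnomalousDissipation.AnomalousDissipation.Theorems.StirringSphereEnsembleRealizationStubCylEnergyIneqGalerkinIdentity
import Summits.AnomalousDissipation.AnomalousDissipation.Theorems.MomentParityPathField
import Literature.Analysis.FluidPDE.StatisticalSolutionEnergyEq

/-!
# Crux `EnsembleRealization` (stmt-AnomalousDissipation-0215) — line `augmented-lift`, tools stub
# `stub_cylEnergyIneqFluxLimit` (S2) for `stub_cylEnergyIneq`

For a stationary statistical solution `μ` at `(ν, f)` (`f` smooth) carried by the ball `‖u‖ ≤ R`,
smooth solenoidal mean-zero `g₁, …, g_m` and a `C¹` profile `ψ(ζ, e)` (`ξ(u) = ((u, gⱼ))ⱼ`):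

* the two integrands of the cylindrically weighted energy inequality,
  `u ↦ ∂ₑψ(ξ(u), |u|²) (ν ‖u‖_V² − (u, f))` and `u ↦ ⟨F(u), Σⱼ ∂ⱼψ(ξ(u), |u|²) gⱼ⟩`, are
  `μ`-integrable (the weights `Dψ(ξ(u), ·)` are continuous and bounded on the ball,
  `exists_bound_fderiv_cylXi`; `‖u‖_V²`, `(u, f)` are integrable by (1.29) and Poincaré;
  `|⟨F(u), gⱼ⟩| ≤ K (1 + |u|²)`, `exists_abs_nsGeneratorPairing_le`);
* the weighted Galerkin fluxes `T_K = ∫ ∂ₑψ(ξ(u), |P_K u|²) ∫ (u ⊗ u) : ∇P_K u dμ` converge, as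
  `K → ∞`, to `D − A/2`, `D` and `A` being the integrals of the two integrands above: by the
  Liouville identity `A_K + 2 B_K = 0` of `stub_cylEnergyIneqGalerkinIdentity` one has
  `T_K = −A_K/2 − W_K` with `W_K = ∫ ∂ₑψ(ξ(u), |P_K u|²) ((f, P_K u) − ν ‖∇P_K u‖²) dμ`, and
  `A_K → A`, `W_K → −D` by dominated convergence (`|P_K u|² → |u|²`, `(f, P_K u) → (f, u)`,
  `‖∇P_K u‖² → ‖u‖_V²` `μ`-a.e., the pattern of `IsStationaryStatisticalSolution.energy_eq_holds`).

So the inequality `D ≥ A/2` of `stub_cylEnergyIneq` is exactly `lim_K T_K ≤ 0` (no mean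
backscatter conditionally on the cylindrical data) — FMRT 2001, Ch. IV (1.30)–(1.31), App. B.1.
-/

noncomputable section
-- every `Summit.AnomalousDissipation.AnomalousDissipation.…` name repeats the summit = sub-problem segment (D-0017 layout)
set_option linter.dupNamespace false

open MeasureTheory Set Filter Topology Function Metric UnitAddTorus
open scoped BigOperators ENNReal InnerProductSpace RealInnerProductSpace
namespace Summit.AnomalousDissipation.AnomalousDissipation.Theorems.EnsembleRealization

open Literature.Analysis.FunctionSpaces Literature.Analysis.FunctionSpaces.Torus
open Literature.Analysis.FluidPDE Literature.Analysis.FluidPDE.Torus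
open Summit.AnomalousDissipation.AnomalousDissipation.Theorems.MomentParity

variable {ν : ℝ} {f : UnitAddTorus (Fin 3) → EuclideanSpace ℝ (Fin 3)}
  {μ : Measure (Torus.energySpace (Fin 3))}
  {m : ℕ} {g : Fin m → UnitAddTorus (Fin 3) → EuclideanSpace ℝ (Fin 3)}
  {ψ : EuclideanSpace ℝ (Fin m) × ℝ → ℝ}

/-! ### Integrability and measurability tools -/

/-- `u ↦ ⟨F(u), w⟩` is `μ`-integrable for a smooth field `w` (continuous on `H` with
`|⟨F(u), w⟩| ≤ K (1 + |u|²)`, and `|u|²` is integrable). -/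
theorem cylFL_integrable_nsGeneratorPairing (hμ : IsStationaryStatisticalSolution ν f μ)
    {w : UnitAddTorus (Fin 3) → EuclideanSpace ℝ (Fin 3)} (hw : IsSmooth w) :
    Integrable (fun u : Torus.energySpace (Fin 3) => nsGeneratorPairing ν f u w) μ := by
  haveI := hμ.prob
  obtain ⟨K, -, hK⟩ := exists_abs_nsGeneratorPairing_le ν f hw
  refine Integrable.mono' (((integrable_const (1 : ℝ)).add hμ.integrable_norm_sq).const_mul K)
    (continuous_nsGeneratorPairing ν f hw).aestronglyMeasurable (ae_of_all _ fun u => ?_)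
  rw [Real.norm_eq_abs]
  exact hK u

/-- A cylindrical weight `u ↦ Dψ(ξ(u), e(u)) v` with a continuous energy `e`, `|e| ≤ R²` on the
ball carrying `μ`, times an integrable function is integrable (the weight is continuous and
bounded a.e., `exists_bound_fderiv_cylXi`). -/
theorem cylFL_integrable_weight_mul {R : ℝ} (hR : ∀ᵐ u ∂μ, ‖u‖ ≤ R) (hg : ∀ j, IsSmooth (g j))
    (hψ : ContDiff ℝ 1 ψ)
    {e : Torus.energySpace (Fin 3) → ℝ} (he : Continuous e)
    (heR : ∀ u : Torus.energySpace (Fin 3), ‖u‖ ≤ R → |e u| ≤ R ^ 2)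
    {F : Torus.energySpace (Fin 3) → ℝ} (hF : Integrable F μ) (v : EuclideanSpace ℝ (Fin m) × ℝ) :
    Integrable (fun u : Torus.energySpace (Fin 3) =>
      fderiv ℝ ψ (WithLp.toLp 2 fun j => pairing u.1 (g j), e u) v * F u) μ := by
  obtain ⟨M, -, hM⟩ := exists_bound_fderiv_cylXi hg hψ R
  refine hF.bdd_mul (continuous_fderiv_cylXi hg hψ he v).aestronglyMeasurable (c := M * ‖v‖) ?_
  filter_upwards [hR] with u hu
  rw [Real.norm_eq_abs]
  exact hM u hu _ (heR u hu) v

/-- The tested generator of the `ξ`-part, `u ↦ ⟨F(u), Σⱼ ∂ⱼψ(ξ(u), e(u)) gⱼ⟩`, is integrable for a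
continuous energy `e` with `|e| ≤ R²` on the ball (linearity in the test field and the two lemmas
above). -/
theorem cylFL_integrable_generator (hf : IsSmooth f) (hμ : IsStationaryStatisticalSolution ν f μ)
    {R : ℝ} (hR : ∀ᵐ u ∂μ, ‖u‖ ≤ R) (hg : ∀ j, IsSmooth (g j)) (hψ : ContDiff ℝ 1 ψ)
    {e : Torus.energySpace (Fin 3) → ℝ} (he : Continuous e)
    (heR : ∀ u : Torus.energySpace (Fin 3), ‖u‖ ≤ R → |e u| ≤ R ^ 2) :
    Integrable (fun u : Torus.energySpace (Fin 3) => nsGeneratorPairing ν f u (fun x => ∑ j,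
      fderiv ℝ ψ (WithLp.toLp 2 fun j => pairing u.1 (g j), e u) (EuclideanSpace.single j 1, 0) •
        g j x)) μ := by
  have h : (fun u : Torus.energySpace (Fin 3) => nsGeneratorPairing ν f u (fun x => ∑ j,
      fderiv ℝ ψ (WithLp.toLp 2 fun j => pairing u.1 (g j), e u) (EuclideanSpace.single j 1, 0) •
        g j x)) = fun u => ∑ j,
      fderiv ℝ ψ (WithLp.toLp 2 fun j => pairing u.1 (g j), e u) (EuclideanSpace.single j 1, 0) *
        nsGeneratorPairing ν f u (g j) :=
    funext fun u => nsGeneratorPairing_sum_smul ν hf.integrable u Finset.univ _ fun j _ => hg j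
  rw [h]
  exact integrable_finsetSum _ fun j _ =>
    cylFL_integrable_weight_mul hR hg hψ he heR (cylFL_integrable_nsGeneratorPairing hμ (hg j)) _

/-- The forcing term `u ↦ (f, P_K u)` is continuous on `H` (a finite sum of Fourier pairings). -/
theorem cylFL_continuous_forcing (hf : MemLp f 2 volume) (K : ℕ) :
    Continuous fun u : Torus.energySpace (Fin 3) =>
      ∫ x, ⟪f x, fourierTruncate K (u.1 : UnitAddTorus (Fin 3) → EuclideanSpace ℝ (Fin 3)) x⟫_ℝ := by
  have h : (fun u : Torus.energySpace (Fin 3) =>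
      ∫ x, ⟪f x, fourierTruncate K (u.1 : UnitAddTorus (Fin 3) → EuclideanSpace ℝ (Fin 3)) x⟫_ℝ) =
      fun u => ∑ k ∈ freqBall K, (inner ℂ (mFourierCoeff (EuclideanSpace.complexify ∘ f) k)
        (mFourierCoeff (EuclideanSpace.complexify ∘
          (u.1 : UnitAddTorus (Fin 3) → EuclideanSpace ℝ (Fin 3))) k)).re := by
    funext u
    rw [fourierTruncate_eq, integral_inner_realTrigPoly_of_integrable _ _ (hf.integrable one_le_two)]
  rw [h]
  exact continuous_finsetSum _ fun k _ => Complex.continuous_re.comp (continuous_const.inner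
    ((continuous_mFourierCoeff_complexify_coe k).comp continuous_subtype_val))

/-- The truncated enstrophy `u ↦ ‖∇P_K u‖²` is measurable on `H` (a finite sum of continuous
functions of finitely many Fourier coefficients). -/
theorem cylFL_measurable_eGradNormSq_fourierTruncate (K : ℕ) :
    Measurable fun u : Torus.energySpace (Fin 3) =>
      eGradNormSq (fourierTruncate K (u.1 : UnitAddTorus (Fin 3) → EuclideanSpace ℝ (Fin 3))) := by
  have h : (fun u : Torus.energySpace (Fin 3) =>
      eGradNormSq (fourierTruncate K (u.1 : UnitAddTorus (Fin 3) → EuclideanSpace ℝ (Fin 3)))) =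
      fun u => ENNReal.ofReal (4 * Real.pi ^ 2) * ∑ k ∈ freqBall K, ENNReal.ofReal (freqNormSq k) *
        ‖mFourierCoeff (EuclideanSpace.complexify ∘
          (u.1 : UnitAddTorus (Fin 3) → EuclideanSpace ℝ (Fin 3))) k‖ₑ ^ 2 :=
    funext fun u => eGradNormSq_fourierTruncate_eq_sum ((Lp.memLp u.1).integrable one_le_two) K
  rw [h]
  refine Measurable.const_mul (Finset.measurable_sum _ fun k _ => Measurable.const_mul ?_ _) _
  exact ((continuous_mFourierCoeff_complexify_coe k).comp
    continuous_subtype_val).measurable.enorm.pow_const 2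

/-- The cylindrical weights along the truncations converge: `Dψ(ξ(u), |P_K u|²) v → Dψ(ξ(u), |u|²) v`
(`|P_K u|² → |u|²`, `Dψ` continuous). -/
theorem cylFL_tendsto_weight (hψ : ContDiff ℝ 1 ψ) (u : Torus.energySpace (Fin 3))
    (v : EuclideanSpace ℝ (Fin m) × ℝ) :
    Tendsto (fun K : ℕ => fderiv ℝ ψ (WithLp.toLp 2 fun j => pairing u.1 (g j), truncNormSq K u) v)
      atTop (𝓝 (fderiv ℝ ψ (WithLp.toLp 2 fun j => pairing u.1 (g j), ‖u‖ ^ 2) v)) := by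
  have hc : Continuous fun t : ℝ =>
      fderiv ℝ ψ ((WithLp.toLp 2 fun j => pairing u.1 (g j) : EuclideanSpace ℝ (Fin m)), t) v :=
    (ContinuousLinearMap.apply ℝ ℝ v).continuous.comp
      ((hψ.continuous_fderiv one_ne_zero).comp (continuous_const.prodMk continuous_id))
  exact (hc.tendsto _).comp (tendsto_truncNormSq u)

/-! ### The stub -/

/-- **S2 `stub_cylEnergyIneqFluxLimit` — integrability of the CEI integrands and the limit of the
weighted Galerkin fluxes.** For a stationary statistical solution `μ` at `(ν, f)`, `f` smooth,
carried by the ball `‖u‖ ≤ R`, smooth solenoidal mean-zero `gⱼ` and a `C¹` profile `ψ`: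
`u ↦ ∂ₑψ(ξ(u), |u|²) (ν ‖u‖_V² − (u, f))` and `u ↦ ⟨F(u), Σⱼ ∂ⱼψ(ξ(u), |u|²) gⱼ⟩` are integrable,
with integrals `D` and `A`, and `∫ ∂ₑψ(ξ(u), |P_K u|²) ∫ (u ⊗ u) : ∇P_K u dμ → D − A/2` as `K → ∞`
(`stub_cylEnergyIneqGalerkinIdentity` rearranged, `T_K = −A_K/2 − W_K`, and dominated convergence
for `A_K → A`, `W_K → −D`). [FMRTTurbulence2001, Ch. IV (1.30)–(1.31), App. B.1] -/
theorem stub_cylEnergyIneqFluxLimit (hf : IsSmooth f) (hμ : IsStationaryStatisticalSolution ν f μ) {R : ℝ} (hR : ∀ᵐ u ∂μ, ‖u‖ ≤ R) {m : ℕ} {g : Fin m → UnitAddTorus (Fin 3) → EuclideanSpace ℝ (Fin 3)} (hg : ∀ j, IsSmooth (g j)) (hgd : ∀ j, IsDivFree (g j)) (hg0 : ∀ j, HasZeroMean (g j)) {ψ : EuclideanSpace ℝ (Fin m) × ℝ → ℝ} (hψ : ContDiff ℝ 1 ψ) : Integrable (fun u : Torus.energySpace (Fin 3) => fderiv ℝ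 ψ (WithLp.toLp 2 fun j => pairing u.1 (g j), ‖u‖ ^ 2) (0, 1) * (ν * (eGradNormSq (u.1 : UnitAddTorus (Fin 3) → EuclideanSpace ℝ (Fin 3))).toReal - pairing u.1 f)) μ ∧ Integrable (fun u : Torus.energySpace (Fin 3) => nsGeneratorPairing ν f u (fun x => ∑ j, fderiv ℝ ψ (WithLp.toLp 2 fun j => pairing u.1 (g j), ‖u‖ ^ 2) (EuclideanSpace.single j 1, 0) • g j x)) μ ∧ Tendsto (fun K : ℕ => ∫ u, fderiv ℝ ψ (WithLp.toLp 2 fun j => pairing u.1 (g j), truncNormSq K u) (0, 1) * inertialPairing u.1 (fourierTruncate K (u.1 : UnitAddTorus (Fin 3) → EuclideanSpace ℝ (Fin 3))) ∂μ) atTop (𝓝 ((∫ u, fderiv ℝ ψ (WithLp.toLp 2 fun j => pairing u.1 (g j), ‖u‖ ^ 2) (0, 1) * (ν * (eGradNormSq (u.1 : UnitAddTorus (Fin 3) → EuclideanSpace ℝ (Fin 3))).toReal - pairing u.1 f) ∂μ) - 2⁻¹ * ∫ u, nsGeneratorPairing ν f u (fun x => ∑ j, fderiv ℝ ψ (WithLp.toLp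 2 fun j => pairing u.1 (g j), ‖u‖ ^ 2) (EuclideanSpace.single j 1, 0) • g j x) ∂μ)) := by
  haveI := hμ.prob
  have hf2 : MemLp f 2 volume := hf.memLp 2
  obtain ⟨M, hM0, hM⟩ := exists_bound_fderiv_cylXi hg hψ R
  have hsqR : ∀ u : Torus.energySpace (Fin 3), ‖u‖ ≤ R → |‖u‖ ^ 2| ≤ R ^ 2 := fun u hu => by
    rw [abs_of_nonneg (sq_nonneg _)]
    exact pow_le_pow_left₀ (norm_nonneg _) hu 2
  have hG : Integrable (fun u : Torus.energySpace (Fin 3) =>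
      (eGradNormSq (u.1 : UnitAddTorus (Fin 3) → EuclideanSpace ℝ (Fin 3))).toReal) μ :=
    hμ.integrable_toReal_eGradNormSq
  have hDint : Integrable (fun u : Torus.energySpace (Fin 3) =>
      ν * (eGradNormSq (u.1 : UnitAddTorus (Fin 3) → EuclideanSpace ℝ (Fin 3))).toReal -
        pairing u.1 f) μ := (hG.const_mul ν).sub (hμ.integrable_pairing hf2)
  refine ⟨cylFL_integrable_weight_mul hR hg hψ (continuous_norm.pow 2) hsqR hDint (0, 1),
    cylFL_integrable_generator hf hμ hR hg hψ (continuous_norm.pow 2) hsqR, ?_⟩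
  -- the pieces `(f, P_K u)` and `‖∇P_K u‖²` of the Galerkin balance are integrable
  have hPint : ∀ K : ℕ, Integrable (fun u : Torus.energySpace (Fin 3) =>
      ∫ x, ⟪f x, fourierTruncate K (u.1 : UnitAddTorus (Fin 3) → EuclideanSpace ℝ (Fin 3)) x⟫_ℝ) μ := by
    intro K
    refine Integrable.mono' (((integrable_const (∫ x, ‖f x‖ ^ 2)).add hμ.integrable_norm_sq).const_mul 2⁻¹)
      (cylFL_continuous_forcing hf2 K).aestronglyMeasurable (ae_of_all _ fun u => ?_)
    rw [Real.norm_eq_abs]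
    refine (abs_integral_inner_le hf2 (memLp_fourierTruncate K _ 2)).trans ?_
    have h := truncNormSq_le K u
    rw [truncNormSq] at h
    simp only [Pi.add_apply]
    gcongr
  have hGKint : ∀ K : ℕ, Integrable (fun u : Torus.energySpace (Fin 3) =>
      (eGradNormSq (fourierTruncate K (u.1 : UnitAddTorus (Fin 3) → EuclideanSpace ℝ (Fin 3)))).toReal) μ := by
    intro K
    refine Integrable.mono' hG
      (cylFL_measurable_eGradNormSq_fourierTruncate K).ennreal_toReal.aestronglyMeasurable ?_
    filter_upwards [hμ.ae_eGradNormSq_lt_top] with u hu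
    rw [Real.norm_eq_abs, abs_of_nonneg ENNReal.toReal_nonneg]
    exact ENNReal.toReal_mono hu.ne
      (eGradNormSq_fourierTruncate_le ((Lp.memLp u.1).integrable one_le_two) K)
  -- `W_K = ∫ ∂ₑψ(ξ(u), |P_K u|²) ((f, P_K u) − ν ‖∇P_K u‖²) dμ` has an integrable integrand
  have hWint : ∀ K : ℕ, Integrable (fun u : Torus.energySpace (Fin 3) =>
      fderiv ℝ ψ (WithLp.toLp 2 fun j => pairing u.1 (g j), truncNormSq K u) (0, 1) *
        ((∫ x, ⟪f x, fourierTruncate K (u.1 : UnitAddTorus (Fin 3) → EuclideanSpace ℝ (Fin 3)) x⟫_ℝ) -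
          ν * (eGradNormSq (fourierTruncate K
            (u.1 : UnitAddTorus (Fin 3) → EuclideanSpace ℝ (Fin 3)))).toReal)) μ := fun K =>
    cylFL_integrable_weight_mul hR hg hψ (cylGI_continuous_truncNormSq K)
      (fun u hu => cylGI_abs_truncNormSq_le hu K) ((hPint K).sub ((hGKint K).const_mul ν)) (0, 1)
  -- the flux integral: `T_K = −A_K/2 − W_K` (the Liouville identity `A_K + 2 B_K = 0`)
  have hflux : ∀ K : ℕ,
      ∫ u, fderiv ℝ ψ (WithLp.toLp 2 fun j => pairing u.1 (g j), truncNormSq K u) (0, 1) *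
        inertialPairing u.1 (fourierTruncate K (u.1 : UnitAddTorus (Fin 3) → EuclideanSpace ℝ (Fin 3))) ∂μ =
      -(2⁻¹ * ∫ u, nsGeneratorPairing ν f u (fun x => ∑ j, fderiv ℝ ψ
          (WithLp.toLp 2 fun j => pairing u.1 (g j), truncNormSq K u) (EuclideanSpace.single j 1, 0) •
            g j x) ∂μ) -
        ∫ u, fderiv ℝ ψ (WithLp.toLp 2 fun j => pairing u.1 (g j), truncNormSq K u) (0, 1) *
          ((∫ x, ⟪f x, fourierTruncate K (u.1 : UnitAddTorus (Fin 3) → EuclideanSpace ℝ (Fin 3)) x⟫_ℝ) -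
            ν * (eGradNormSq (fourierTruncate K
              (u.1 : UnitAddTorus (Fin 3) → EuclideanSpace ℝ (Fin 3)))).toReal) ∂μ := by
    intro K
    obtain ⟨-, hBK, hid⟩ := stub_cylEnergyIneqGalerkinIdentity hf hμ hR hg hgd hg0 hψ K
    have hpt : (fun u : Torus.energySpace (Fin 3) =>
        fderiv ℝ ψ (WithLp.toLp 2 fun j => pairing u.1 (g j), truncNormSq K u) (0, 1) *
          inertialPairing u.1 (fourierTruncate K (u.1 : UnitAddTorus (Fin 3) → EuclideanSpace ℝ (Fin 3)))) =
        fun u => fderiv ℝ ψ (WithLp.toLp 2 fun j => pairing u.1 (g j), truncNormSq K u) (0, 1) *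
            galerkinBalance ν f K u -
          fderiv ℝ ψ (WithLp.toLp 2 fun j => pairing u.1 (g j), truncNormSq K u) (0, 1) *
            ((∫ x, ⟪f x, fourierTruncate K (u.1 : UnitAddTorus (Fin 3) → EuclideanSpace ℝ (Fin 3)) x⟫_ℝ) -
              ν * (eGradNormSq (fourierTruncate K
                (u.1 : UnitAddTorus (Fin 3) → EuclideanSpace ℝ (Fin 3)))).toReal) := by
      funext u
      rw [galerkinBalance]
      ring
    rw [hpt, integral_sub hBK (hWint K)]
    linarith
  -- `A_K → A` by dominated convergence
  have hlin : ∀ (e : ℝ) (u : Torus.energySpace (Fin 3)), nsGeneratorPairing ν f u (fun x => ∑ j,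
      fderiv ℝ ψ (WithLp.toLp 2 fun j => pairing u.1 (g j), e) (EuclideanSpace.single j 1, 0) • g j x) =
      ∑ j, fderiv ℝ ψ (WithLp.toLp 2 fun j => pairing u.1 (g j), e) (EuclideanSpace.single j 1, 0) *
        nsGeneratorPairing ν f u (g j) := fun e u =>
    nsGeneratorPairing_sum_smul ν hf.integrable u Finset.univ _ fun j _ => hg j
  have hA : Tendsto (fun K : ℕ => ∫ u, nsGeneratorPairing ν f u (fun x => ∑ j, fderiv ℝ ψ
      (WithLp.toLp 2 fun j => pairing u.1 (g j), truncNormSq K u) (EuclideanSpace.single j 1, 0) •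
        g j x) ∂μ) atTop (𝓝 (∫ u, nsGeneratorPairing ν f u (fun x => ∑ j, fderiv ℝ ψ
      (WithLp.toLp 2 fun j => pairing u.1 (g j), ‖u‖ ^ 2) (EuclideanSpace.single j 1, 0) •
        g j x) ∂μ)) := by
    have hGi : ∀ j, Integrable (fun u : Torus.energySpace (Fin 3) => nsGeneratorPairing ν f u (g j)) μ :=
      fun j => cylFL_integrable_nsGeneratorPairing hμ (hg j)
    refine tendsto_integral_of_dominated_convergence
      (fun u => ∑ j, M * ‖((EuclideanSpace.single j (1 : ℝ) : EuclideanSpace ℝ (Fin m)), (0 : ℝ))‖ *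
        ‖nsGeneratorPairing ν f u (g j)‖)
      (fun K => (stub_cylEnergyIneqGalerkinIdentity hf hμ hR hg hgd hg0 hψ K).1.aestronglyMeasurable)
      (integrable_finsetSum _ fun j _ => (hGi j).norm.const_mul _) (fun K => ?_) (ae_of_all _ fun u => ?_)
    · filter_upwards [hR] with u hu
      rw [hlin, Real.norm_eq_abs]
      refine (Finset.abs_sum_le_sum_abs _ _).trans (Finset.sum_le_sum fun j _ => ?_)
      rw [abs_mul, Real.norm_eq_abs]
      exact mul_le_mul_of_nonneg_right (hM u hu _ (cylGI_abs_truncNormSq_le hu K) _) (abs_nonneg _)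
    · simp_rw [hlin]
      exact tendsto_finsetSum _ fun j _ => (cylFL_tendsto_weight hψ u _).mul_const _
  -- `W_K → −D` by dominated convergence
  have hW : Tendsto (fun K : ℕ => ∫ u, fderiv ℝ ψ (WithLp.toLp 2 fun j => pairing u.1 (g j),
      truncNormSq K u) (0, 1) *
        ((∫ x, ⟪f x, fourierTruncate K (u.1 : UnitAddTorus (Fin 3) → EuclideanSpace ℝ (Fin 3)) x⟫_ℝ) -
          ν * (eGradNormSq (fourierTruncate K
            (u.1 : UnitAddTorus (Fin 3) → EuclideanSpace ℝ (Fin 3)))).toReal) ∂μ) atTop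
      (𝓝 (∫ u, -(fderiv ℝ ψ (WithLp.toLp 2 fun j => pairing u.1 (g j), ‖u‖ ^ 2) (0, 1) *
        (ν * (eGradNormSq (u.1 : UnitAddTorus (Fin 3) → EuclideanSpace ℝ (Fin 3))).toReal -
          pairing u.1 f)) ∂μ)) := by
    refine tendsto_integral_of_dominated_convergence
      (fun u => M * ‖((0 : EuclideanSpace ℝ (Fin m)), (1 : ℝ))‖ *
        (2⁻¹ * ((∫ x, ‖f x‖ ^ 2) + ‖u‖ ^ 2) +
          |ν| * (eGradNormSq (u.1 : UnitAddTorus (Fin 3) → EuclideanSpace ℝ (Fin 3))).toReal))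
      (fun K => (hWint K).aestronglyMeasurable)
      (((((integrable_const _).add hμ.integrable_norm_sq).const_mul _).add (hG.const_mul _)).const_mul _)
      (fun K => ?_) ?_
    · filter_upwards [hR, hμ.ae_eGradNormSq_lt_top] with u hu hufin
      have hint : Integrable (u.1 : UnitAddTorus (Fin 3) → EuclideanSpace ℝ (Fin 3)) volume :=
        (Lp.memLp u.1).integrable one_le_two
      have hw := hM u hu _ (cylGI_abs_truncNormSq_le hu K) (0, 1)
      have hP : |∫ x, ⟪f x, fourierTruncate K (u.1 : UnitAddTorus (Fin 3) → EuclideanSpace ℝ (Fin 3)) x⟫_ℝ| ≤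
          2⁻¹ * ((∫ x, ‖f x‖ ^ 2) + ‖u‖ ^ 2) := by
        refine (abs_integral_inner_le hf2 (memLp_fourierTruncate K _ 2)).trans ?_
        have h := truncNormSq_le K u
        rw [truncNormSq] at h
        gcongr
      have hGK0 : 0 ≤ (eGradNormSq (fourierTruncate K
          (u.1 : UnitAddTorus (Fin 3) → EuclideanSpace ℝ (Fin 3)))).toReal := ENNReal.toReal_nonneg
      have hGK : (eGradNormSq (fourierTruncate K
          (u.1 : UnitAddTorus (Fin 3) → EuclideanSpace ℝ (Fin 3)))).toReal ≤
          (eGradNormSq (u.1 : UnitAddTorus (Fin 3) → EuclideanSpace ℝ (Fin 3))).toReal :=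
        ENNReal.toReal_mono hufin.ne (eGradNormSq_fourierTruncate_le hint K)
      rw [Real.norm_eq_abs, abs_mul]
      refine mul_le_mul hw ((abs_sub _ _).trans (add_le_add hP ?_)) (abs_nonneg _) (by positivity)
      rw [abs_mul, abs_of_nonneg hGK0]
      exact mul_le_mul_of_nonneg_left hGK (abs_nonneg ν)
    · filter_upwards [hμ.ae_eGradNormSq_lt_top] with u hufin
      have hmem : MemLp (u.1 : UnitAddTorus (Fin 3) → EuclideanSpace ℝ (Fin 3)) 2 volume := Lp.memLp _
      have hpair : ∫ x, ⟪f x, (u.1 : UnitAddTorus (Fin 3) → EuclideanSpace ℝ (Fin 3)) x⟫_ℝ =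
          pairing u.1 f := by
        rw [pairing]
        exact integral_congr_ae (ae_of_all _ fun x => real_inner_comm _ _)
      have t1 := tendsto_integral_inner_fourierTruncate hf2 hmem
      rw [hpair] at t1
      have t2 := (tendsto_toReal_eGradNormSq_fourierTruncate (hmem.integrable one_le_two)
        hufin.ne).const_mul ν
      have t3 := (cylFL_tendsto_weight (g := g) hψ u (0, 1)).mul (t1.sub t2)
      have e : fderiv ℝ ψ (WithLp.toLp 2 fun j => pairing u.1 (g j), ‖u‖ ^ 2) (0, 1) *
          (pairing u.1 f - ν * (eGradNormSq (u.1 : UnitAddTorus (Fin 3) → EuclideanSpace ℝ (Fin 3))).toReal) =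
          -(fderiv ℝ ψ (WithLp.toLp 2 fun j => pairing u.1 (g j), ‖u‖ ^ 2) (0, 1) *
            (ν * (eGradNormSq (u.1 : UnitAddTorus (Fin 3) → EuclideanSpace ℝ (Fin 3))).toReal -
              pairing u.1 f)) := by ring
      rw [e] at t3
      exact t3
  rw [integral_neg] at hW
  -- conclusion
  rw [show (fun K : ℕ => ∫ u, fderiv ℝ ψ (WithLp.toLp 2 fun j => pairing u.1 (g j), truncNormSq K u)
      (0, 1) * inertialPairing u.1 (fourierTruncate K
        (u.1 : UnitAddTorus (Fin 3) → EuclideanSpace ℝ (Fin 3))) ∂μ) = _ from funext hflux]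
  convert ((hA.const_mul 2⁻¹).neg).sub hW using 2
  ring

end Summit.AnomalousDissipation.AnomalousDissipation.Theorems.EnsembleRealization
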